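import Literature.NumberTheory.LFunctions.WeilTrigBrackets
-- import Literature.NumberTheory.LFunctions.WeilFirstPrimeQuadratic  -- (not needed: soundness is stated with the weight unfolded)
import Literature.Analysis.ValidatedNumerics.TrigLogTables
import HarnessLib

/-!
# Certified cells for the first-prime Weil weight `w₂(t) = Re ψ(1/4 + it/2) − √2 log 2 cos(t log 2)`

Support for a moment-method certificate of first-prime Weil positivity (`WeilPositivityOn a` with
`log 2 < 2a ≤ log 3`, the semi-local case `S = {∞, 2}` of Connes' trace formula; analytic form
`Literature.NumberTheory.LFunctions.weilFirstPrimeQuadratic`, `WeilFirstPrimeQuadratic.lean`).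
The weight of the analytic form is the archimedean density of Yoshida's (2.1) minus the ripple
`√2 log 2 · cos(t log 2)` of the prime `2`. This file builds kernel-checkable piecewise-polynomial
minorant CELLS for that weight:

* the engine constants `log 2`, `√2`, `√2 log 2` and the point values `cos(u log 2)`, `sin(u log 2)`
  as fixed-point intervals of the tree's verified engine (`Literature.Analysis.ValidatedNumerics`:
  `FI.logTable`, `FI.cosSin`), read off as rationals (`logTwoLoQ/HiQ`, `alphaLoQ`, `betaLoQ`);
* `FPCell` = a `WeilCell` for the digamma part (soundness `WeilCell.sigma_le`,
  `WeilPositivityMinorant.lean`) plus a checker-computed rational polynomial lower bound of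
  `−√2 log 2 cos(t log 2)` on the cell (addition formula at the left end point and the brackets of
  `WeilTrigBrackets.lean`); its polynomial `FPCell.sigma`, Boolean `FPCell.check` and soundness
  `FPCell.sigma_le` (`σ ≤ w₂` on the cell, with `w₂` written out), `FPCell.sigma_le_level`
  (`σ ≤ wL`), exact moments `FPCell.momentQ` (`FPCell.integral_level_sub_sigma_mul_pow`).

The chain of cells, the even extension and the moment identity used by the certificate are in
`WeilFirstPrimeMinorant.lean`. Everything here is proved; there are no named facts.

## References

* H. Yoshida, *On Hermitian forms attached to zeta functions*, Adv. Stud. Pure Math. 21 (1992), §6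
  (certified control of `Re ψ(1/4 + it/2)` by series and monotonicity).
* R. E. Moore, *Interval Analysis* (1966), Ch. 3 (interval extensions of `cos`, `sin`, `log`).
-/

noncomputable section

open Complex Finset MeasureTheory Set Filter
open scoped Real Topology BigOperators

namespace Literature.NumberTheory.LFunctions

open Literature.Analysis.ValidatedNumerics.Numerics

/-! ## Engine constants: `log 2`, `√2`, `√2 log 2`, `cos(u log 2)`, `sin(u log 2)` -/

/-- `log 2` as a fixed-point interval of the engine (`FI.logTable`). [folklore] -/
def logTwoFI : FI := (FI.logTable 2).getD 2 (FI.ofInt 0)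

/-- The engine accepts the table up to `2`. [folklore] -/
theorem logTableOK_two : FI.logTableOK 2 = true := by
  decide +kernel

/-- `log 2 ∈ logTwoFI`. [folklore] -/
theorem mem_logTwoFI : FI.mem (Real.log 2) logTwoFI := by
  have h := FI.mem_logTable logTableOK_two (le_refl 2)
  simpa [logTwoFI] using h

/-- A rational below `√2`. [folklore] -/
def sqrtTwoLoQ : ℚ := 14142135623730950488 / 10000000000000000000

/-- A rational above `√2`. [folklore] -/
def sqrtTwoHiQ : ℚ := 14142135623730950489 / 10000000000000000000

/-- `sqrtTwoLoQ ≤ √2 ≤ sqrtTwoHiQ`. [folklore] -/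
theorem sqrtTwo_mem : (sqrtTwoLoQ : ℝ) ≤ Real.sqrt 2 ∧ Real.sqrt 2 ≤ (sqrtTwoHiQ : ℝ) := by
  constructor
  · rw [Real.le_sqrt (by unfold sqrtTwoLoQ; positivity) (by norm_num)]
    unfold sqrtTwoLoQ; norm_num
  · rw [Real.sqrt_le_left (by unfold sqrtTwoHiQ; positivity)]
    unfold sqrtTwoHiQ; norm_num

/-- `√2` as a fixed-point interval. [folklore] -/
def sqrtTwoFI : FI := FI.ofRatRat sqrtTwoLoQ sqrtTwoHiQ

/-- `√2 ∈ sqrtTwoFI`. [folklore] -/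
theorem mem_sqrtTwoFI : FI.mem (Real.sqrt 2) sqrtTwoFI :=
  FI.mem_ofRatRat sqrtTwo_mem.1 sqrtTwo_mem.2

/-- `c₀ = √2 log 2` (the amplitude of the prime-2 ripple) as a fixed-point interval. [folklore] -/
def cZeroFI : FI := FI.mul sqrtTwoFI logTwoFI

/-- `√2 log 2 ∈ cZeroFI`. [folklore] -/
theorem mem_cZeroFI : FI.mem (Real.sqrt 2 * Real.log 2) cZeroFI :=
  FI.mem_mul mem_sqrtTwoFI mem_logTwoFI

/-- Rational lower end of the `log 2` interval. [folklore] -/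
def logTwoLoQ : ℚ := logTwoFI.loQ

/-- Rational upper end of the `log 2` interval. [folklore] -/
def logTwoHiQ : ℚ := logTwoFI.hiQ

/-- `logTwoLoQ ≤ log 2 ≤ logTwoHiQ`. [folklore] -/
theorem logTwo_mem_Q : (logTwoLoQ : ℝ) ≤ Real.log 2 ∧ Real.log 2 ≤ (logTwoHiQ : ℝ) :=
  ⟨FI.loQ_le mem_logTwoFI, FI.le_hiQ mem_logTwoFI⟩

/-- `u log 2` as an interval, for a rational `u`. [folklore] -/
def thetaFI (u : ℚ) : FI := FI.mul (FI.ofRat u) logTwoFI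

/-- `u log 2 ∈ thetaFI u`. [folklore] -/
theorem mem_thetaFI (u : ℚ) : FI.mem ((u : ℝ) * Real.log 2) (thetaFI u) :=
  FI.mem_mul (FI.mem_ofRat u) mem_logTwoFI

/-- A rational `≤ α(u) := −√2 log 2 · cos(u log 2)`. [folklore] -/
def alphaLoQ (u : ℚ) : ℚ := (FI.neg (FI.mul cZeroFI (FI.cosSin (thetaFI u)).1)).loQ

/-- A rational `≤ β(u) := √2 log 2 · sin(u log 2)`. [folklore] -/
def betaLoQ (u : ℚ) : ℚ := (FI.mul cZeroFI (FI.cosSin (thetaFI u)).2).loQ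

/-- `alphaLoQ u ≤ −√2 log 2 cos(u log 2)`. [folklore] -/
theorem alphaLoQ_le (u : ℚ) :
    (alphaLoQ u : ℝ) ≤ -(Real.sqrt 2 * Real.log 2 * Real.cos ((u : ℝ) * Real.log 2)) := by
  have h := (FI.mem_cosSin (mem_thetaFI u)).1
  have hm := FI.mem_neg (FI.mem_mul mem_cZeroFI h)
  exact FI.loQ_le hm

/-- `betaLoQ u ≤ √2 log 2 sin(u log 2)`. [folklore] -/
theorem betaLoQ_le (u : ℚ) :
    (betaLoQ u : ℝ) ≤ Real.sqrt 2 * Real.log 2 * Real.sin ((u : ℝ) * Real.log 2) := by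
  have h := (FI.mem_cosSin (mem_thetaFI u)).2
  exact FI.loQ_le (FI.mem_mul mem_cZeroFI h)

/-! ## First-prime cells -/

/-- A cell of a certified minorant of `w₂`: a digamma cell `psi` (for `Re ψ(1/4 + it/2)` on
`[u, v]`) and the truncation order `n ≥ 1` of the trigonometric brackets; the rational polynomial
lower bound of the ripple `−√2 log 2 cos(t log 2)` on the cell is COMPUTED by the checker
(`FPCell.cosPart`). [folklore] -/
structure FPCell where
  /-- the digamma cell on `[u, v]` -/
  psi : WeilCell
  /-- order of the Maclaurin brackets of `cos(hL)`, `sin(hL)`, `h = t − u` -/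
  n : ℕ

namespace FPCell

variable (c : FPCell)

/-- The bracket of `cos(hL)` used with the sign of `alphaLoQ`: lower if `α_lo ≥ 0`, upper otherwise. [folklore] -/
def cosBracket : List ℚ :=
  if 0 ≤ alphaLoQ c.psi.u then cosLoCoeffs logTwoLoQ logTwoHiQ c.n
  else cosUpCoeffs logTwoLoQ logTwoHiQ c.n

/-- The bracket of `sin(hL)` used with the sign of `betaLoQ`. [folklore] -/
def sinBracket : List ℚ :=
  if 0 ≤ betaLoQ c.psi.u then sinLoCoeffs logTwoLoQ logTwoHiQ c.n
  else sinUpCoeffs logTwoLoQ logTwoHiQ c.n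

/-- The ripple polynomial of the cell: coefficients of `h^k`, `h = t − u`, of
`α_lo · (cos bracket) + β_lo · (sin bracket)`, a lower bound of `−√2 log 2 cos(t log 2)`. [folklore] -/
def cosPart : List ℚ :=
  tabV (c.n + 1) fun k ↦ alphaLoQ c.psi.u * getV c.cosBracket k + betaLoQ c.psi.u * getV c.sinBracket k

/-- The cell polynomial `σ(t) = σ_ψ(t) + P(t − u)`. [folklore] -/
def sigma (t : ℝ) : ℝ := c.psi.sigma t + polyR c.cosPart (t - c.psi.u)

/-- `Σ_k |p_k| (v − u)^k`, an upper bound of `|P|` on the cell. [folklore] -/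
def absPartQ : ℚ := sumR (c.n + 1) fun k ↦ |getV c.cosPart k| * (c.psi.v - c.psi.u) ^ k

/-- All checks of a first-prime cell against the level `wL`: the digamma cell is checked (with its
own level test neutralised), `n ≥ 1`, `0 ≤ logTwoLoQ`, `(v − u) · logTwoHiQ ≤ 1` (so `0 ≤ hL ≤ 1` on the
cell), and `posPart(σ_ψ) + Σ|p_k|(v−u)^k ≤ wL`. [folklore] -/
def check (p : ℕ) (wL : ℚ) : Bool :=
  c.psi.check p c.psi.posPartQ && decide (0 < c.n) && decide (0 ≤ logTwoLoQ) &&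
    decide ((c.psi.v - c.psi.u) * logTwoHiQ ≤ 1) && decide (c.psi.posPartQ + c.absPartQ ≤ wL)

variable {c} {p : ℕ} {wL : ℚ}

/-- Unpacking `check`. [folklore] -/
theorem check_spec (h : c.check p wL = true) :
    c.psi.check p c.psi.posPartQ = true ∧ 0 < c.n ∧ 0 ≤ logTwoLoQ ∧
      (c.psi.v - c.psi.u) * logTwoHiQ ≤ 1 ∧ c.psi.posPartQ + c.absPartQ ≤ wL := by
  simp only [check, Bool.and_eq_true, decide_eq_true_eq] at h
  exact ⟨h.1.1.1.1, h.1.1.1.2, h.1.1.2, h.1.2, h.2⟩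

/-- A checked cell has `0 ≤ u`. [folklore] -/
theorem u_nonneg (h : c.check p wL = true) : 0 ≤ c.psi.u :=
  WeilCell.u_nonneg (check_spec h).1

/-- A checked cell has `u < v`. [folklore] -/
theorem u_lt_v (h : c.check p wL = true) : c.psi.u < c.psi.v :=
  WeilCell.u_lt_v (check_spec h).1

/-- Lengths of the brackets. [folklore] -/
theorem length_cosBracket (c : FPCell) : c.cosBracket.length = c.n + 1 := by
  unfold cosBracket cosLoCoeffs cosUpCoeffs; split_ifs <;> simp [tabV]

/-- Lengths of the brackets. [folklore] -/
theorem length_sinBracket (c : FPCell) : c.sinBracket.length = c.n + 1 := by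
  unfold sinBracket sinLoCoeffs sinUpCoeffs; split_ifs <;> simp [tabV]

/-- `P(h) = α_lo · (cos bracket)(h) + β_lo · (sin bracket)(h)`. [folklore] -/
theorem polyR_cosPart (c : FPCell) (h : ℝ) :
    polyR c.cosPart h = (alphaLoQ c.psi.u : ℝ) * polyR c.cosBracket h +
      (betaLoQ c.psi.u : ℝ) * polyR c.sinBracket h := by
  unfold cosPart
  rw [polyR_tabV]
  unfold polyR
  rw [length_cosBracket, length_sinBracket, Finset.mul_sum, Finset.mul_sum, ← Finset.sum_add_distrib]
  refine Finset.sum_congr rfl fun k _ ↦ ?_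
  push_cast
  ring

/-- **Ripple soundness.** On the cell, `P(t − u) ≤ −√2 log 2 cos(t log 2)`. [folklore] -/
theorem polyR_cosPart_le (h : c.check p wL = true) {t : ℝ} (hut : (c.psi.u : ℝ) ≤ t)
    (htv : t ≤ (c.psi.v : ℝ)) :
    polyR c.cosPart (t - c.psi.u) ≤ -(Real.sqrt 2 * Real.log 2 * Real.cos (t * Real.log 2)) := by
  obtain ⟨-, hn, hL0q, hwq, -⟩ := check_spec h
  set L : ℝ := Real.log 2 with hLdef
  set u : ℝ := (c.psi.u : ℝ) with hudef
  set hh : ℝ := t - u with hhdef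
  have hL0 : (0 : ℝ) ≤ logTwoLoQ := by exact_mod_cast hL0q
  have hL1 : (logTwoLoQ : ℝ) ≤ L := logTwo_mem_Q.1
  have hL2 : L ≤ (logTwoHiQ : ℝ) := logTwo_mem_Q.2
  have hLnn : 0 ≤ L := hL0.trans hL1
  have hh0 : 0 ≤ hh := by rw [hhdef]; linarith
  have hhw : hh ≤ (c.psi.v : ℝ) - c.psi.u := by rw [hhdef, hudef]; linarith
  have hhL : hh * L ≤ 1 := by
    have h1 : hh * L ≤ ((c.psi.v : ℝ) - c.psi.u) * logTwoHiQ :=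
      mul_le_mul hhw hL2 hLnn (by linarith)
    have h2 : ((c.psi.v : ℝ) - c.psi.u) * logTwoHiQ ≤ 1 := by exact_mod_cast hwq
    linarith
  have hy0 : 0 ≤ hh * L := mul_nonneg hh0 hLnn
  have hcos0 : 0 ≤ Real.cos (hh * L) :=
    Real.cos_nonneg_of_mem_Icc ⟨by linarith [Real.pi_pos], by linarith [Real.pi_gt_three]⟩
  have hsin0 : 0 ≤ Real.sin (hh * L) :=
    Real.sin_nonneg_of_nonneg_of_le_pi hy0 (by linarith [Real.pi_gt_three])
  -- addition formula at the left end point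
  set α : ℝ := -(Real.sqrt 2 * Real.log 2 * Real.cos (u * L)) with hαdef
  set β : ℝ := Real.sqrt 2 * Real.log 2 * Real.sin (u * L) with hβdef
  have hadd : -(Real.sqrt 2 * Real.log 2 * Real.cos (t * Real.log 2)) =
      α * Real.cos (hh * L) + β * Real.sin (hh * L) := by
    have : t * Real.log 2 = u * L + hh * L := by rw [hhdef, hLdef]; ring
    rw [this, Real.cos_add, hαdef, hβdef]
    ring
  have ha : (alphaLoQ c.psi.u : ℝ) ≤ α := by rw [hαdef, hudef, hLdef]; exact alphaLoQ_le c.psi.u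
  have hb : (betaLoQ c.psi.u : ℝ) ≤ β := by rw [hβdef, hudef, hLdef]; exact betaLoQ_le c.psi.u
  rw [hadd, polyR_cosPart]
  refine add_le_add ?_ ?_
  · unfold cosBracket
    split_ifs with hsgn
    · have h0 : (0 : ℝ) ≤ alphaLoQ c.psi.u := by exact_mod_cast hsgn
      calc (alphaLoQ c.psi.u : ℝ) * polyR (cosLoCoeffs logTwoLoQ logTwoHiQ c.n) hh
          ≤ (alphaLoQ c.psi.u : ℝ) * Real.cos (hh * L) :=
            mul_le_mul_of_nonneg_left (polyR_cosLo_le hL0 hL1 hL2 hh0 hhL hn) h0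
        _ ≤ α * Real.cos (hh * L) := mul_le_mul_of_nonneg_right ha hcos0
    · push Not at hsgn
      have h0 : (alphaLoQ c.psi.u : ℝ) ≤ 0 := by exact_mod_cast hsgn.le
      calc (alphaLoQ c.psi.u : ℝ) * polyR (cosUpCoeffs logTwoLoQ logTwoHiQ c.n) hh
          ≤ (alphaLoQ c.psi.u : ℝ) * Real.cos (hh * L) :=
            mul_le_mul_of_nonpos_left (cos_le_polyR_cosUp hL0 hL1 hL2 hh0 hhL hn) h0
        _ ≤ α * Real.cos (hh * L) := mul_le_mul_of_nonneg_right ha hcos0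
  · unfold sinBracket
    split_ifs with hsgn
    · have h0 : (0 : ℝ) ≤ betaLoQ c.psi.u := by exact_mod_cast hsgn
      calc (betaLoQ c.psi.u : ℝ) * polyR (sinLoCoeffs logTwoLoQ logTwoHiQ c.n) hh
          ≤ (betaLoQ c.psi.u : ℝ) * Real.sin (hh * L) :=
            mul_le_mul_of_nonneg_left (polyR_sinLo_le hL0 hL1 hL2 hh0 hhL hn) h0
        _ ≤ β * Real.sin (hh * L) := mul_le_mul_of_nonneg_right hb hsin0
    · push Not at hsgn
      have h0 : (betaLoQ c.psi.u : ℝ) ≤ 0 := by exact_mod_cast hsgn.le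
      calc (betaLoQ c.psi.u : ℝ) * polyR (sinUpCoeffs logTwoLoQ logTwoHiQ c.n) hh
          ≤ (betaLoQ c.psi.u : ℝ) * Real.sin (hh * L) :=
            mul_le_mul_of_nonpos_left (sin_le_polyR_sinUp hL0 hL1 hL2 hh0 hhL hn) h0
        _ ≤ β * Real.sin (hh * L) := mul_le_mul_of_nonneg_right hb hsin0

/-- **Cell soundness.** On its cell, `σ(t) ≤ Re ψ(1/4 + it/2) − √2 log 2 cos(t log 2) = w₂(t)`. [folklore] -/
theorem sigma_le (h : c.check p wL = true) {t : ℝ} (hut : (c.psi.u : ℝ) ≤ t) (htv : t ≤ (c.psi.v : ℝ)) :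
    c.sigma t ≤ Literature.Analysis.SpecialFunctions.reDigammaQuarter t -
      Real.sqrt 2 * Real.log 2 * Real.cos (t * Real.log 2) := by
  have h1 := WeilCell.sigma_le (check_spec h).1 hut htv
  have h2 := polyR_cosPart_le h hut htv
  unfold sigma
  linarith

/-- Cast of `absPartQ`. [folklore] -/
theorem absPartQ_cast (c : FPCell) :
    ((c.absPartQ : ℚ) : ℝ) = ∑ k ∈ Finset.range (c.n + 1),
      |((getV c.cosPart k : ℚ) : ℝ)| * ((c.psi.v : ℝ) - c.psi.u) ^ k := by
  unfold absPartQ; rw [sumR_eq_sum]; push_cast; rfl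

/-- On its cell, `σ(t) ≤ wL` (so the local `γ = wL − σ ≥ 0`). [folklore] -/
theorem sigma_le_level (h : c.check p wL = true) {t : ℝ} (hut : (c.psi.u : ℝ) ≤ t)
    (htv : t ≤ (c.psi.v : ℝ)) : c.sigma t ≤ wL := by
  obtain ⟨hpsi, -, -, -, hlev⟩ := check_spec h
  have h1 : c.psi.sigma t ≤ c.psi.posPartQ := WeilCell.sigma_le_level hpsi hut htv
  have hlen : c.cosPart.length = c.n + 1 := by simp [cosPart, tabV]
  have h2 := abs_polyR_le c.cosPart (h := t - c.psi.u) (w := (c.psi.v : ℝ) - c.psi.u)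
    (by linarith) (by linarith)
  rw [hlen, ← absPartQ_cast] at h2
  have h3 : polyR c.cosPart (t - c.psi.u) ≤ c.absPartQ := (le_abs_self _).trans h2
  have h4 : ((c.psi.posPartQ : ℚ) : ℝ) + c.absPartQ ≤ wL := by exact_mod_cast hlev
  unfold sigma
  linarith

/-- Continuity of the cell polynomial. [folklore] -/
theorem continuous_sigma (c : FPCell) : Continuous c.sigma := by
  unfold sigma polyR
  exact c.psi.continuous_sigma.add (continuous_finsetSum _ fun k _ ↦ by fun_prop)

/-! ### Exact moments of a first-prime cell -/

/-- `∫_u^v (s − u)^k s^q ds` in closed form: `Σ_i C(k,i) (−u)^{k−i} (v^{i+q+1} − u^{i+q+1})/(i+q+1)`. [folklore] -/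
def shiftPowIntQ (c : FPCell) (k q : ℕ) : ℚ :=
  sumR (k + 1) fun i ↦ ((k.choose i : ℕ) : ℚ) * (-c.psi.u) ^ (k - i) * c.psi.powIntQ (i + q + 1)

/-- `∫_u^v (wL − σ(s)) s^q ds` in closed form. [folklore] -/
def momentQ (wL : ℚ) (c : FPCell) (q : ℕ) : ℚ :=
  c.psi.momentQ wL q - sumR (c.n + 1) fun k ↦ getV c.cosPart k * c.shiftPowIntQ k q

/-- `∫_u^v (s − u)^k s^q ds = shiftPowIntQ`. [folklore] -/
theorem integral_shift_pow_mul_pow (c : FPCell) (k q : ℕ) :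
    ∫ s in (c.psi.u : ℝ)..c.psi.v, (s - c.psi.u) ^ k * s ^ q = (c.shiftPowIntQ k q : ℝ) := by
  have hexp : ∀ s : ℝ, (s - c.psi.u) ^ k * s ^ q =
      ∑ i ∈ Finset.range (k + 1), ((k.choose i : ℕ) : ℝ) * (-(c.psi.u : ℝ)) ^ (k - i) * s ^ (i + q) := by
    intro s
    rw [sub_eq_add_neg, add_pow, Finset.sum_mul]
    refine Finset.sum_congr rfl fun i _ ↦ ?_
    rw [pow_add]; ring
  simp_rw [hexp]
  rw [intervalIntegral.integral_finsetSum
    (f := fun i s ↦ ((k.choose i : ℕ) : ℝ) * (-(c.psi.u : ℝ)) ^ (k - i) * s ^ (i + q))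
    (fun i _ ↦ (by fun_prop : Continuous fun s : ℝ ↦
      ((k.choose i : ℕ) : ℝ) * (-(c.psi.u : ℝ)) ^ (k - i) * s ^ (i + q)).intervalIntegrable _ _)]
  unfold shiftPowIntQ
  rw [sumR_eq_sum]
  push_cast
  refine Finset.sum_congr rfl fun i _ ↦ ?_
  rw [intervalIntegral.integral_const_mul, WeilCell.integral_pow_eq_powIntQ]

/-- **Cell moments.** `∫_u^v (wL − σ(s)) s^q ds = momentQ`. [folklore] -/
theorem integral_level_sub_sigma_mul_pow (wL : ℚ) (c : FPCell) (q : ℕ) :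
    ∫ s in (c.psi.u : ℝ)..c.psi.v, ((wL : ℝ) - c.sigma s) * s ^ q = (c.momentQ wL q : ℝ) := by
  have hlen : c.cosPart.length = c.n + 1 := by simp [cosPart, tabV]
  have hpt : ∀ s : ℝ, ((wL : ℝ) - c.sigma s) * s ^ q =
      ((wL : ℝ) - c.psi.sigma s) * s ^ q -
        ∑ k ∈ Finset.range (c.n + 1), ((getV c.cosPart k : ℚ) : ℝ) * ((s - c.psi.u) ^ k * s ^ q) := by
    intro s
    unfold sigma polyR
    rw [hlen]
    have : (∑ k ∈ Finset.range (c.n + 1), ((getV c.cosPart k : ℚ) : ℝ) * (s - c.psi.u) ^ k) * s ^ q =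
        ∑ k ∈ Finset.range (c.n + 1), ((getV c.cosPart k : ℚ) : ℝ) * ((s - c.psi.u) ^ k * s ^ q) := by
      rw [Finset.sum_mul]
      exact Finset.sum_congr rfl fun k _ ↦ by ring
    rw [show ((wL : ℝ) - (c.psi.sigma s + ∑ k ∈ Finset.range (c.n + 1),
        ((getV c.cosPart k : ℚ) : ℝ) * (s - c.psi.u) ^ k)) * s ^ q =
        ((wL : ℝ) - c.psi.sigma s) * s ^ q - (∑ k ∈ Finset.range (c.n + 1),
        ((getV c.cosPart k : ℚ) : ℝ) * (s - c.psi.u) ^ k) * s ^ q by ring, this]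
  simp_rw [hpt]
  have i0 : IntervalIntegrable (fun s ↦ ((wL : ℝ) - c.psi.sigma s) * s ^ q) volume c.psi.u c.psi.v :=
    ((continuous_const.sub c.psi.continuous_sigma).mul (continuous_pow q)).intervalIntegrable _ _
  have iK : ∀ k, IntervalIntegrable
      (fun s : ℝ ↦ ((getV c.cosPart k : ℚ) : ℝ) * ((s - c.psi.u) ^ k * s ^ q)) volume c.psi.u c.psi.v :=
    fun k ↦ (continuous_const.mul ((continuous_pow k |>.comp (continuous_sub_right _)).mul
      (continuous_pow q))).intervalIntegrable _ _
  have iS : IntervalIntegrable (fun s : ℝ ↦ ∑ k ∈ Finset.range (c.n + 1),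
      ((getV c.cosPart k : ℚ) : ℝ) * ((s - c.psi.u) ^ k * s ^ q)) volume c.psi.u c.psi.v :=
    (continuous_finsetSum _ fun k _ ↦ (continuous_const.mul ((continuous_pow k |>.comp
      (continuous_sub_right _)).mul (continuous_pow q)))).intervalIntegrable _ _
  rw [intervalIntegral.integral_sub i0 iS, WeilCell.integral_level_sub_sigma_mul_pow,
    intervalIntegral.integral_finsetSum fun k _ ↦ iK k]
  unfold momentQ
  rw [sumR_eq_sum]
  push_cast
  congr 1
  refine Finset.sum_congr rfl fun k _ ↦ ?_
  rw [intervalIntegral.integral_const_mul, integral_shift_pow_mul_pow]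

end FPCell

end Literature.NumberTheory.LFunctions
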